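import Mathlib
import HarnessLib.Audit
import Summits.PneNP.PneNP.Theorems.PstarCross
import Summits.PneNP.PneNP.Theorems.PstarUnionFive
import Summits.PneNP.PneNP.Theorems.PstarMultiUnion
import Summits.PneNP.PneNP.Theorems.PstarChordReadShared
import Summits.PneNP.PneNP.Theorems.PstarChordReadCoupledSplit

/-!
# ONE CROSS GATE, II — a pinned partner reduces the cross gate to the UNION LEMMA (ROUND-25; planner p3 g23, memo `r24/CORE-BOUND-NOTES.md` §14.31)

FRONTIER range-avoidance ladder, rung F-N3, ROUND 25 (cell `pnp-ideate`).  Restricted-model proof complexity; nothing here bears on `P` versus `NP`.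

Setting of `PstarCross.TerminalFiveCross1`: a terminal pair `(w₁, w₂)` on the core `J₀`, one cross gate `g₀ = x_p · x_q` among the monomials of `w₁`
(`p, q` private AND variables of two different chords), everything else `hun`-clean.  Let `Z := Sol_y(J₀) ∩ {w₂ = t₂}`.

* **Case I (a partner is pinned): `unionTerminal_of_pinned`.**  If `x_q ≡ c` on `Z` then on `Z` the constraint `w₁` agrees with
  `A₀ := (w₁ ∖ g₀) + c·x_p` (monomials `w₁.2.1.erase g₀`, hun-clean), and with `A₁ := A₀ + x_q` (target `t₁ + c`) the data
  `(J₀; A₀, A₁, w₂)` is `PstarUnion.UnionTerminal`: both pairs are infeasible on `J₀` (they agree with `w₁` resp. `w₁ + c + x_q` on `Z`), and an output `f`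
  not released by `(A₀, w₂)` is released by `(A₁, w₂)` at the very witness of `Terminal` (there `x_q = ¬c`, else `A₀ = w₁ = t₁` would release `f`, and
  `A₀ = ¬t₁`, so `A₁ = ¬t₁ + ¬c = t₁ + c`).  The linear parts differ by `{x_q}`, an AND-slot variable (`Typed`).  Hence `unionFive_holds` gives `#J₀ ≤ 5`:
  `cross1_card_le_five_of_pinned`.
* **Case II (both partners free on `Z`) is the residual: `TerminalFiveCross1Free` (OPEN, `@[conjecture]`)**, and
  `terminalFiveCross1_of_free : TerminalFiveCross1Free → TerminalFiveCross1` (proved here).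
  What is known about Case II (memo §14.31): if moreover `w₂` reads none of the four privates of the two chords `e_p, e_q` linearly, then fibrewise over the
  interior assignment `Z` is a product over the chord privates, `T3` forces `w₁ ⊇ x_p + x_q + x_p x_q` (an OR of the two privates) and
  `Z ⊆ {m_{e_p} = 1} ∪ {m_{e_q} = 1}` — a CONS/NOR-type configuration expected to be small; otherwise `w₂` reads a private of `e_p` or `e_q` linearly and the
  chord-read machinery (`PstarUnionCaseBReads`, `PstarChordReads*`) is the tool.  Census: K18 (k ≤ 7, pendant monomials between core AND variables included)
  found no terminal configuration with `#J₀ ≥ 6`.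
-/

set_option linter.dupNamespace false -- `Summit.PneNP.PneNP.…`: summit = sub-problem name (D-0017 single-conjunct layout)

open Finset Literature.Computability.Complexity
open scoped symmDiff
open Summit.PneNP.PneNP.Theorems.PstarTyped (Typed)
open Summit.PneNP.PneNP.Theorems.PstarSALevel (varSet bdry BoundaryExpanding SimpleOverlap)
open Summit.PneNP.PneNP.Theorems.PstarGapOneAll (gval)
open Summit.PneNP.PneNP.Theorems.PstarCoreBound (XorClosed)
open Summit.PneNP.PneNP.Theorems.PstarChordRepair (IsChord)
open Summit.PneNP.PneNP.Theorems.PstarChordBridgeCotree (Peelable)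
open Summit.PneNP.PneNP.Theorems.PstarChordBridgeTools (privs)
open Summit.PneNP.PneNP.Theorems.PstarCoreBoundTargets (Terminal TerminalFiveA)
open Summit.PneNP.PneNP.Theorems.PstarUnion (SatPair UnionTerminal UnionFive)
open Summit.PneNP.PneNP.Theorems.PstarUnionFive (unionFive_holds)
open Summit.PneNP.PneNP.Theorems.PstarMultiUnion (LocalUnionTerminal LocalUnionFive)
open Summit.PneNP.PneNP.Theorems.PstarCross (CrossGate TerminalFiveCross1)
open Summit.PneNP.PneNP.Theorems.PstarChordReadShared (gval_singleton gval_symmDiff_singleton)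
open Summit.PneNP.PneNP.Theorems.PstarChordReadCoupledSplit (gval_erase_mono)

namespace Summit.PneNP.PneNP.Theorems.PstarCross2

variable {n m : ℕ}

/-- `x_v ≡ c` on `Z = Sol_y(J₀) ∩ {w₂ = t₂}`, in `SatPair` language: the pair `(x_v = ¬c, w₂)` is infeasible on `J₀`. -/
def PinnedTo (I : LocalMap 4 n m) (y : Fin m → Bool) (J₀ : Finset (Fin m)) (w₂ : Finset (Fin n) × Finset (Fin m) × Bool)
    (v : Fin n) (c : Bool) : Prop :=
  ¬ SatPair I y J₀ (({v} : Finset (Fin n)), (∅ : Finset (Fin m)), !c) w₂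

/-- The effective first member after freezing the partner `q` of the cross gate `g₀ = x_p x_q` at the value `c`: `A₀ = (w₁ ∖ g₀) + c · x_p`. -/
def crossA₀ (w₁ : Finset (Fin n) × Finset (Fin m) × Bool) (g₀ : Fin m) (p : Fin n) (c : Bool) :
    Finset (Fin n) × Finset (Fin m) × Bool :=
  (if c = true then w₁.1 ∆ {p} else w₁.1, w₁.2.1.erase g₀, w₁.2.2)

/-- The second member: `A₁ = A₀ + x_q` with target `t₁ + c`. -/
def crossA₁ (w₁ : Finset (Fin n) × Finset (Fin m) × Bool) (g₀ : Fin m) (p q : Fin n) (c : Bool) :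
    Finset (Fin n) × Finset (Fin m) × Bool :=
  ((crossA₀ w₁ g₀ p c).1 ∆ {q}, w₁.2.1.erase g₀, xor w₁.2.2 c)

/-- A pinned variable takes its pinned value at every point of `Z`. -/
theorem eq_of_pinnedTo {I : LocalMap 4 n m} {y : Fin m → Bool} {J₀ : Finset (Fin m)} {w₂ : Finset (Fin n) × Finset (Fin m) × Bool}
    {q : Fin n} {c : Bool} (hpin : PinnedTo I y J₀ w₂ q c) {x : Fin n → Bool}
    (hsol : ∀ j ∈ J₀, I.eval x j = y j) (hw : gval I w₂.1 w₂.2.1 x = w₂.2.2) : x q = c := by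
  by_contra hx
  apply hpin
  refine ⟨x, hsol, ?_, hw⟩
  show gval I {q} ∅ x = !c
  rw [gval_singleton]
  revert hx; cases x q <;> cases c <;> simp

/-- On `{x_q = c}` the effective member `A₀` agrees with `w₁`. -/
theorem gval_crossA₀ (I : LocalMap 4 n m) (w₁ : Finset (Fin n) × Finset (Fin m) × Bool) {g₀ : Fin m} (hg₀ : g₀ ∈ w₁.2.1)
    {p q : Fin n} (hpq : (p = I.vars g₀ 2 ∧ q = I.vars g₀ 3) ∨ (p = I.vars g₀ 3 ∧ q = I.vars g₀ 2)) {c : Bool}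
    {x : Fin n → Bool} (hx : x q = c) :
    gval I (crossA₀ w₁ g₀ p c).1 (crossA₀ w₁ g₀ p c).2.1 x = gval I w₁.1 w₁.2.1 x := by
  have hmono : (x (I.vars g₀ 2) && x (I.vars g₀ 3)) = (x p && c) := by
    rcases hpq with ⟨rfl, rfl⟩ | ⟨rfl, rfl⟩
    · rw [hx]
    · rw [hx, Bool.and_comm]
  rw [gval_erase_mono I w₁.1 w₁.2.1 g₀ x, decide_eq_true hg₀, Bool.true_and, hmono]
  cases c
  · simp [crossA₀]
  · simp [crossA₀, gval_symmDiff_singleton]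

/-- `A₁ = A₀ + x_q` pointwise. -/
theorem gval_crossA₁ (I : LocalMap 4 n m) (w₁ : Finset (Fin n) × Finset (Fin m) × Bool) (g₀ : Fin m) (p q : Fin n) (c : Bool)
    (x : Fin n → Bool) :
    gval I (crossA₁ w₁ g₀ p q c).1 (crossA₁ w₁ g₀ p q c).2.1 x = xor (gval I (crossA₀ w₁ g₀ p c).1 (crossA₀ w₁ g₀ p c).2.1 x) (x q) := by
  show gval I ((crossA₀ w₁ g₀ p c).1 ∆ {q}) (w₁.2.1.erase g₀) x = _
  rw [gval_symmDiff_singleton]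
  rfl

/-- **CASE I of the one-cross-gate target: a pinned partner makes the terminal pair a UNION-TERMINAL datum** with hun-clean monomials
`w₁.2.1.erase g₀`. -/
theorem unionTerminal_of_pinned (I : LocalMap 4 n m) (hT : Typed I) {r : ℕ} {y : Fin m → Bool} {J₀ : Finset (Fin m)}
    {w₁ w₂ : Finset (Fin n) × Finset (Fin m) × Bool} (ht : Terminal I r y J₀ w₁ w₂) {g₀ : Fin m} (hg₀ : g₀ ∈ w₁.2.1)
    {p q : Fin n} (hpq : (p = I.vars g₀ 2 ∧ q = I.vars g₀ 3) ∨ (p = I.vars g₀ 3 ∧ q = I.vars g₀ 2)) {c : Bool}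
    (hpin : PinnedTo I y J₀ w₂ q c) :
    UnionTerminal I r y J₀ (crossA₀ w₁ g₀ p c) (crossA₁ w₁ g₀ p q c) w₂ := by
  classical
  obtain ⟨hne, hX, hcard, hd₁, hd₂, hrad, hT3, hM0⟩ := ht
  have hq : q = I.vars g₀ 2 ∨ q = I.vars g₀ 3 := by
    rcases hpq with ⟨-, h⟩ | ⟨-, h⟩
    · exact Or.inr h
    · exact Or.inl h
  refine ⟨hne, hX, hcard, rfl, ?_, hd₂, ?_, ?_, ?_, ?_, ?_⟩
  · -- disjointness: the monomial set shrank
    exact hd₁.mono_right (erase_subset _ _)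
  · -- radius
    refine le_trans (card_le_card ?_) hrad
    exact union_subset_union (union_subset_union le_rfl (erase_subset _ _)) le_rfl
  · -- the linear parts differ by `{q}`, an AND-slot variable
    intro v hv j _
    have hv' : v = q := by
      have : (crossA₀ w₁ g₀ p c).1 ∆ (crossA₁ w₁ g₀ p q c).1 = {q} := by
        show (crossA₀ w₁ g₀ p c).1 ∆ ((crossA₀ w₁ g₀ p c).1 ∆ {q}) = {q}
        exact symmDiff_symmDiff_cancel_left _ _
      rw [this] at hv
      exact mem_singleton.mp hv
    subst hv'
    rcases hq with h | h
    · exact ⟨fun h' => hT j g₀ 0 2 (by decide) (by decide) (h'.trans h), fun h' => hT j g₀ 1 2 (by decide) (by decide) (h'.trans h)⟩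
    · exact ⟨fun h' => hT j g₀ 0 3 (by decide) (by decide) (h'.trans h), fun h' => hT j g₀ 1 3 (by decide) (by decide) (h'.trans h)⟩
  · -- `(A₀, w₂)` infeasible on `J₀`
    rintro ⟨x, hsol, hA, hw⟩
    have hxq := eq_of_pinnedTo hpin hsol hw
    rw [gval_crossA₀ I w₁ hg₀ hpq hxq] at hA
    exact hT3 ⟨x, hsol, hA, hw⟩
  · -- `(A₁, w₂)` infeasible on `J₀`
    rintro ⟨x, hsol, hA, hw⟩
    have hxq := eq_of_pinnedTo hpin hsol hw
    rw [gval_crossA₁, gval_crossA₀ I w₁ hg₀ hpq hxq, hxq] at hA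
    apply hT3 ⟨x, hsol, ?_, hw⟩
    revert hA
    show xor (gval I w₁.1 w₁.2.1 x) c = xor w₁.2.2 c → gval I w₁.1 w₁.2.1 x = w₁.2.2
    cases gval I w₁.1 w₁.2.1 x <;> cases c <;> cases w₁.2.2 <;> simp
  · -- cover
    intro f hf
    by_cases h0 : SatPair I y (J₀.erase f) (crossA₀ w₁ g₀ p c) w₂
    · exact Or.inl h0
    · right
      obtain ⟨x, hsol, h₁, hw⟩ := hM0 f hf
      have hxq : x q = !c := by
        -- if `x_q = c` the effective member agrees with `w₁` at `x`, releasing `f` through `A₀`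
        by_contra hne'
        have hx : x q = c := by
          revert hne'
          cases x q <;> cases c <;> simp
        exact h0 ⟨x, hsol, by rw [gval_crossA₀ I w₁ hg₀ hpq hx]; exact h₁, hw⟩
      have hA₀ : gval I (crossA₀ w₁ g₀ p c).1 (crossA₀ w₁ g₀ p c).2.1 x = !w₁.2.2 := by
        have : gval I (crossA₀ w₁ g₀ p c).1 (crossA₀ w₁ g₀ p c).2.1 x ≠ w₁.2.2 := fun h => h0 ⟨x, hsol, h, hw⟩
        revert this
        cases gval I (crossA₀ w₁ g₀ p c).1 (crossA₀ w₁ g₀ p c).2.1 x <;> cases w₁.2.2 <;> simp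
      refine ⟨x, hsol, ?_, hw⟩
      show gval I (crossA₁ w₁ g₀ p q c).1 (crossA₁ w₁ g₀ p q c).2.1 x = xor w₁.2.2 c
      rw [gval_crossA₁, hA₀, hxq]
      cases w₁.2.2 <;> cases c <;> rfl

/-- **CASE I settled:** a terminal core with one cross gate one of whose variables is pinned on `Z` has at most five outputs (by `unionFive_holds`). -/
theorem cross1_card_le_five_of_pinned {r : ℕ} (I : LocalMap 4 n m) (hI : I.IsPure xorAndPred) (hT : Typed I) (hS : SimpleOverlap I)
    (hB : BoundaryExpanding r I) {y : Fin m → Bool} {J₀ : Finset (Fin m)} {w₁ w₂ : Finset (Fin n) × Finset (Fin m) × Bool}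
    (ht : Terminal I r y J₀ w₁ w₂) {F : Finset (Fin m)} (hF : F ⊆ J₀) (hP : Peelable I F)
    (hmax : ∀ F', F ⊆ F' → F' ⊆ J₀ → Peelable I F' → F' = F) (hch : ∀ e ∈ J₀ \ F, IsChord I J₀ e)
    {g₀ : Fin m} (hg₀ : g₀ ∈ w₁.2.1)
    (hun : ∀ g ∈ (w₁.2.1.erase g₀) ∪ w₂.2.1, ∀ v ∈ privs I (J₀ \ F), I.vars g 2 ≠ v ∧ I.vars g 3 ≠ v)
    {p q : Fin n} (hpq : (p = I.vars g₀ 2 ∧ q = I.vars g₀ 3) ∨ (p = I.vars g₀ 3 ∧ q = I.vars g₀ 2)) {c : Bool}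
    (hpin : PinnedTo I y J₀ w₂ q c) : J₀.card ≤ 5 :=
  unionFive_holds n m r I hI hT hS hB y J₀ _ _ w₂ (unionTerminal_of_pinned I hT ht hg₀ hpq hpin) F hF hP hmax hch hun

/-- **RESIDUAL TARGET (OPEN): one cross gate, BOTH partners free on `Z`.**  As `TerminalFiveCross1`, plus: each AND variable of `g₀` takes both values on
`Z = Sol_y(J₀) ∩ {w₂ = t₂}`.  FRONTIER. -/
@[conjecture] def TerminalFiveCross1Free : Prop :=
  ∀ (n m r : ℕ) (I : LocalMap 4 n m), I.IsPure xorAndPred → Typed I → SimpleOverlap I → BoundaryExpanding r I →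
  ∀ (y : Fin m → Bool) (J₀ : Finset (Fin m)) (w₁ w₂ : Finset (Fin n) × Finset (Fin m) × Bool), Terminal I r y J₀ w₁ w₂ →
    ∀ F ⊆ J₀, Peelable I F → (∀ F', F ⊆ F' → F' ⊆ J₀ → Peelable I F' → F' = F) → (∀ e ∈ J₀ \ F, IsChord I J₀ e) →
    ∀ g₀ ∈ w₁.2.1, CrossGate I J₀ F g₀ →
    (∀ g ∈ (w₁.2.1.erase g₀) ∪ w₂.2.1, ∀ v ∈ privs I (J₀ \ F), I.vars g 2 ≠ v ∧ I.vars g 3 ≠ v) →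
    (∀ c : Bool, SatPair I y J₀ (({I.vars g₀ 2} : Finset (Fin n)), (∅ : Finset (Fin m)), c) w₂) →
    (∀ c : Bool, SatPair I y J₀ (({I.vars g₀ 3} : Finset (Fin n)), (∅ : Finset (Fin m)), c) w₂) →
    J₀.card ≤ 5

/-- **The one-cross-gate target reduces to its free case** (Case I is the union lemma). -/
theorem terminalFiveCross1_of_free (hfree : TerminalFiveCross1Free) : TerminalFiveCross1 := by
  intro n m r I hI hT hS hB y J₀ w₁ w₂ ht F hF hP hmax hch g₀ hg₀ hcg hun
  by_cases h2 : ∀ c : Bool, SatPair I y J₀ (({I.vars g₀ 2} : Finset (Fin n)), (∅ : Finset (Fin m)), c) w₂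
  · by_cases h3 : ∀ c : Bool, SatPair I y J₀ (({I.vars g₀ 3} : Finset (Fin n)), (∅ : Finset (Fin m)), c) w₂
    · exact hfree n m r I hI hT hS hB y J₀ w₁ w₂ ht F hF hP hmax hch g₀ hg₀ hcg hun h2 h3
    · push Not at h3
      obtain ⟨c, hc⟩ := h3
      have hpin : PinnedTo I y J₀ w₂ (I.vars g₀ 3) (!c) := by simpa [PinnedTo] using hc
      exact cross1_card_le_five_of_pinned I hI hT hS hB ht hF hP hmax hch hg₀ hun (Or.inl ⟨rfl, rfl⟩) hpin
  · push Not at h2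
    obtain ⟨c, hc⟩ := h2
    have hpin : PinnedTo I y J₀ w₂ (I.vars g₀ 2) (!c) := by simpa [PinnedTo] using hc
    exact cross1_card_le_five_of_pinned I hI hT hS hB ht hF hP hmax hch hg₀ hun (Or.inr ⟨rfl, rfl⟩) hpin


/-! ## Case II split by whether `w₂` reads a private of the two chords touched by the cross gate (memo §14.31 (IIa)/(IIb)) -/

/-- The chords of `J₀ ∖ F` touched by the gate `g₀` (those having an AND variable of `g₀` among their privates). -/
def touchedBy (I : LocalMap 4 n m) (J₀ F : Finset (Fin m)) (g₀ : Fin m) : Finset (Fin m) :=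
  (J₀ \ F).filter fun e => I.vars g₀ 2 = I.vars e 2 ∨ I.vars g₀ 2 = I.vars e 3 ∨ I.vars g₀ 3 = I.vars e 2 ∨ I.vars g₀ 3 = I.vars e 3

/-- **(IIa) BLIND `w₂` (OPEN):** Case II where `w₂` reads NO private of the chords touched by `g₀` (then, memo §14.31: `Z` is fibrewise a product over those
privates, `T3` forces `w₁ ⊇ x_p ∨ x_q`, `A_int ≡ t₁` on `Z` and `Z ⊆ {m_{e_p} = 1} ∪ {m_{e_q} = 1}` — a corner/NOR-shaped configuration).  FRONTIER. -/
@[conjecture] def TerminalFiveCross1Blind : Prop :=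
  ∀ (n m r : ℕ) (I : LocalMap 4 n m), I.IsPure xorAndPred → Typed I → SimpleOverlap I → BoundaryExpanding r I →
  ∀ (y : Fin m → Bool) (J₀ : Finset (Fin m)) (w₁ w₂ : Finset (Fin n) × Finset (Fin m) × Bool), Terminal I r y J₀ w₁ w₂ →
    ∀ F ⊆ J₀, Peelable I F → (∀ F', F ⊆ F' → F' ⊆ J₀ → Peelable I F' → F' = F) → (∀ e ∈ J₀ \ F, IsChord I J₀ e) →
    ∀ g₀ ∈ w₁.2.1, CrossGate I J₀ F g₀ →
    (∀ g ∈ (w₁.2.1.erase g₀) ∪ w₂.2.1, ∀ v ∈ privs I (J₀ \ F), I.vars g 2 ≠ v ∧ I.vars g 3 ≠ v) →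
    (∀ c : Bool, SatPair I y J₀ (({I.vars g₀ 2} : Finset (Fin n)), (∅ : Finset (Fin m)), c) w₂) →
    (∀ c : Bool, SatPair I y J₀ (({I.vars g₀ 3} : Finset (Fin n)), (∅ : Finset (Fin m)), c) w₂) →
    (∀ e ∈ touchedBy I J₀ F g₀, I.vars e 2 ∉ w₂.1 ∧ I.vars e 3 ∉ w₂.1) →
    J₀.card ≤ 5

/-- **(IIb) `w₂` READS a private of a touched chord (OPEN):** the chord-read world (a reader of a free private; direction picture).  FRONTIER. -/
@[conjecture] def TerminalFiveCross1Read : Prop :=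
  ∀ (n m r : ℕ) (I : LocalMap 4 n m), I.IsPure xorAndPred → Typed I → SimpleOverlap I → BoundaryExpanding r I →
  ∀ (y : Fin m → Bool) (J₀ : Finset (Fin m)) (w₁ w₂ : Finset (Fin n) × Finset (Fin m) × Bool), Terminal I r y J₀ w₁ w₂ →
    ∀ F ⊆ J₀, Peelable I F → (∀ F', F ⊆ F' → F' ⊆ J₀ → Peelable I F' → F' = F) → (∀ e ∈ J₀ \ F, IsChord I J₀ e) →
    ∀ g₀ ∈ w₁.2.1, CrossGate I J₀ F g₀ →
    (∀ g ∈ (w₁.2.1.erase g₀) ∪ w₂.2.1, ∀ v ∈ privs I (J₀ \ F), I.vars g 2 ≠ v ∧ I.vars g 3 ≠ v) →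
    (∀ c : Bool, SatPair I y J₀ (({I.vars g₀ 2} : Finset (Fin n)), (∅ : Finset (Fin m)), c) w₂) →
    (∀ c : Bool, SatPair I y J₀ (({I.vars g₀ 3} : Finset (Fin n)), (∅ : Finset (Fin m)), c) w₂) →
    ∀ e ∈ touchedBy I J₀ F g₀, (I.vars e 2 ∈ w₂.1 ∨ I.vars e 3 ∈ w₂.1) →
    J₀.card ≤ 5

/-- Glue: Case II = (IIa) ∨ (IIb). -/
theorem terminalFiveCross1Free_of (hA : TerminalFiveCross1Blind) (hB : TerminalFiveCross1Read) : TerminalFiveCross1Free := by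
  intro n m r I hI hT hS hB' y J₀ w₁ w₂ ht F hF hP hmax hch g₀ hg₀ hcg hun h2 h3
  by_cases hbl : ∀ e ∈ touchedBy I J₀ F g₀, I.vars e 2 ∉ w₂.1 ∧ I.vars e 3 ∉ w₂.1
  · exact hA n m r I hI hT hS hB' y J₀ w₁ w₂ ht F hF hP hmax hch g₀ hg₀ hcg hun h2 h3 hbl
  · push Not at hbl
    obtain ⟨e, he, hr⟩ := hbl
    have hr' : I.vars e 2 ∈ w₂.1 ∨ I.vars e 3 ∈ w₂.1 := by
      by_cases h : I.vars e 2 ∈ w₂.1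
      · exact Or.inl h
      · exact Or.inr (hr h)
    exact hB n m r I hI hT hS hB' y J₀ w₁ w₂ ht F hF hP hmax hch g₀ hg₀ hcg hun h2 h3 e he hr'

/-- The whole one-cross-gate target from the two Case-II halves. -/
theorem terminalFiveCross1_of (hA : TerminalFiveCross1Blind) (hB : TerminalFiveCross1Read) : TerminalFiveCross1 :=
  terminalFiveCross1_of_free (terminalFiveCross1Free_of hA hB)

/-! ## PINNED PARTNERS IN GENERAL — every monomial of `w₁` with a variable pinned on `Z` linearises into a LOCAL-UNION member (memo §14.31 lesson)

For a set `M ⊆ w₁.2.1` of monomials `g`, each with a chosen slot `sl g ∈ {2,3}` whose variable is pinned on `Z` to `c g`, put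
`A₀ := w₁` with every `g ∈ M` replaced by `c g · x_{partner}` (`pinA₀`).  On `Z`, `A₀ ≡ w₁`, so `(A₀, w₂)` is infeasible on `J₀`; and an output `f` not
released by `(A₀, w₂)` is released by `A₁ := A₀ + Σ_{g ∈ S} x_{I.vars g (sl g)}` (target shifted by `Σ_S c g`) where `S := {g ∈ M : x(partner g) = 1}` at the
Terminal witness `x` of `f` — an AND-linear modification depending on `f`.  Hence `LocalUnionTerminal (A₀, w₂)` — the linearisation
`localUnionTerminal_of_pinnedPartners` is proved in `PstarPinnedPartners`, where `LocalUnionFive` (`PstarLocalUnionFive.localUnionFive_holds`) then settles the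
class of O2 in which `w₂` is hun-clean and EVERY privates-touching monomial of `w₁` has a variable pinned on `Z` (`TerminalFivePinned`, typed here).  The residual
of O2 is therefore: some privates-touching monomial has BOTH variables free on `Z`.

Statements and definitions VERBATIM from planner p3 g23's `r25/SketchCross2.lean` (22:11Z); the sorried linearisation item and its corollary moved to
`PstarPinnedPartners`. -/

/-- The partner slot. -/
def pt (sl : Fin m → Fin 4) (g : Fin m) : Fin 4 := if sl g = 2 then 3 else 2

/-- The linear correction: variables that are the partner of an odd number of monomials `g ∈ M` pinned to `true`. -/
def pinLin (I : LocalMap 4 n m) (M : Finset (Fin m)) (sl : Fin m → Fin 4) (c : Fin m → Bool) : Finset (Fin n) :=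
  Finset.univ.filter fun v => Odd (M.filter fun g => c g = true ∧ I.vars g (pt sl g) = v).card

/-- `A₀ := w₁` with the monomials of `M` linearised at their pinned values. -/
def pinA₀ (I : LocalMap 4 n m) (w₁ : Finset (Fin n) × Finset (Fin m) × Bool) (M : Finset (Fin m)) (sl : Fin m → Fin 4) (c : Fin m → Bool) :
    Finset (Fin n) × Finset (Fin m) × Bool :=
  (w₁.1 ∆ pinLin I M sl c, w₁.2.1 \ M, w₁.2.2)

/-- **TARGET (OPEN): the PINNED-PARTNER class of O2** — `w₂` hun-clean, and every monomial of `w₁` outside a set `M` of monomials each having a variable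
pinned on `Z` is hun-clean (so every privates-touching monomial of `w₁` is in `M`).  FRONTIER. -/
@[conjecture] def TerminalFivePinned : Prop :=
  ∀ (n m r : ℕ) (I : LocalMap 4 n m), I.IsPure xorAndPred → Typed I → SimpleOverlap I → BoundaryExpanding r I →
  ∀ (y : Fin m → Bool) (J₀ : Finset (Fin m)) (w₁ w₂ : Finset (Fin n) × Finset (Fin m) × Bool), Terminal I r y J₀ w₁ w₂ →
    ∀ F ⊆ J₀, Peelable I F → (∀ F', F ⊆ F' → F' ⊆ J₀ → Peelable I F' → F' = F) → (∀ e ∈ J₀ \ F, IsChord I J₀ e) →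
    ∀ M ⊆ w₁.2.1, ∀ (sl : Fin m → Fin 4) (c : Fin m → Bool), (∀ g ∈ M, sl g = 2 ∨ sl g = 3) →
    (∀ g ∈ M, PinnedTo I y J₀ w₂ (I.vars g (sl g)) (c g)) →
    (∀ g ∈ (w₁.2.1 \ M) ∪ w₂.2.1, ∀ v ∈ privs I (J₀ \ F), I.vars g 2 ≠ v ∧ I.vars g 3 ≠ v) →
    J₀.card ≤ 5

/-- `TerminalFivePinned` is a sub-target of O2. -/
theorem terminalFivePinned_of_terminalFiveA (h : TerminalFiveA) : TerminalFivePinned :=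
  fun n m r I hI hT hS hB y J₀ w₁ w₂ ht F hF hP hmax hch _ _ _ _ _ _ _ => h n m r I hI hT hS hB y J₀ w₁ w₂ ht F hF hP hmax hch

end Summit.PneNP.PneNP.Theorems.PstarCross2
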